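import Summits.CriticalPhenomena.SAWScalingLimit.Theorems.SAWRenewalTightnessEventualTightBoundedExterior
import Summits.CriticalPhenomena.SAWScalingLimit.Theorems.SAWRenewalTightnessEventualTightAspectReduction
import Summits.CriticalPhenomena.SAWScalingLimit.Theorems.SAWRenewalTightnessEventualTightSplit

/-!
# `EventualTight`, line `Sketch` v9: the crux and its bulk child from the BOUNDED-EXTERIOR atom X2c₁ᵇ

Crux stmt-CriticalPhenomena-1372 (`SAWRenewalTightness.EventualTight`), line `Sketch`, registration v9 (lead c6).  The end
state of the line with the weakened bulk atom X2c₁ᵇ (`stub_virginArcTraversalTightBounded`: the virgin-arc traversal bound for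
FINITE exteriors confined to `B̄(z₀, C·N)`, `k` depending on `C`; see `…BoundedExterior.lean`), composed from landed files:

* `virginArcTraversalTightBounded_of_finite`: v8's atom X2c₁ᶠ (hence X2c₁ = stmt-CriticalPhenomena-17940) implies X2c₁ᵇ
  (drop the confinement hypothesis) — everything stmt-17940 closed it still closes;
* `bulkShellTightAtAspectTwo_of_virginArcTraversalTightBounded` = V4ʳ ∘ B (`…BoundedExterior.lean`);
* `bulkShellTight_of_virginArcTraversalTightBounded`: then the aspect reduction A (`stub_aspectReduction`, p143627) gives the
  bulk child `BulkShellTight` (stmt-CriticalPhenomena-17588, verbatim);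
* `eventualTight_of_virginArcTraversalTightBounded_of_confinementPositivity`: with restriction positivity E
  (`ConfinementPositivity`, stmt-CriticalPhenomena-17587, verbatim) the split glue `EventualTight_of_subs` (p142144) gives
  the crux.

So `EventualTight ⟸ E ∧ X2c₁ᵇ`; neither hypothesis is asserted here (both research-grade).
[cite: AizenmanBurchardDuke1999, Thm 1.1] [cite: DuminilCopinSmirnov2012, §2]
-/

noncomputable section

open MeasureTheory Filter Topology Set Metric
open scoped ENNReal NNReal unitInterval
open Literature.Probability.RandomPlanarGeometry Literature.Probability.LatticeModels

namespace Summit.CriticalPhenomena.SAWScalingLimit.Theorems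

/-- **X2c₁ᶠ ⇒ X2c₁ᵇ**: the finite-exterior atom of v8 (verbatim `stub_virginArcTraversalTightFinite`) implies the
bounded-exterior atom of v9 (verbatim `stub_virginArcTraversalTightBounded`) — forget the confinement `Λ ⊆ B̄(z₀, C·N)`.
[folklore] -/
theorem virginArcTraversalTightBounded_of_finite :
    (∀ θ : ℝ, 0 < θ →
      ∃ (k : ℕ) (N₀ : ℝ), 0 < N₀ ∧
        ∀ (H : SimpleGraph (Site 2)) (Λ : Set (Site 2)) (z₀ : ℂ) (N : ℝ) (u c u' c' : Site 2),
          Λ.Finite → N₀ ≤ N →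
          (H ≤ zdGraph 2 ∧ (∀ v : Site 2, dist (Site.toComplex v) z₀ ≤ N → v ∈ Λ) ∧
            ∀ v v' : Site 2, dist (Site.toComplex v) z₀ ≤ N + 1 →
              dist (Site.toComplex v') z₀ ≤ N + 1 → (zdGraph 2).Adj v v' → H.Adj v v') →
          (H.Adj u c ∧ u ∉ Λ ∧ c ∈ Λ ∧ dist (Site.toComplex c) z₀ ≤ N ∧
            N < dist (Site.toComplex u) z₀) →
          (H.Adj u' c' ∧ u' ∉ Λ ∧ c' ∈ Λ ∧ dist (Site.toComplex c') z₀ ≤ N ∧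
            N < dist (Site.toComplex u') z₀) →
          ∑' p : {p : {p : H.Walk c c' // p.IsPath ∧ ∀ v ∈ p.support, v ∈ Λ} //
              ∃ ι κ : Fin k → Fin (p.1.support.map Site.toComplex).length, (∀ m, ι m ≤ κ m) ∧
                (∀ m, (dist ((p.1.support.map Site.toComplex).get (ι m)) z₀ ≤ 2 * N / 5 ∧
                    3 * N / 5 ≤ dist ((p.1.support.map Site.toComplex).get (κ m)) z₀) ∨
                  (3 * N / 5 ≤ dist ((p.1.support.map Site.toComplex).get (ι m)) z₀ ∧
                    dist ((p.1.support.map Site.toComplex).get (κ m)) z₀ ≤ 2 * N / 5)) ∧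
                ∀ ⦃m m'⦄, m < m' → κ m ≤ ι m'},
              ENNReal.ofReal (SAW.criticalFugacity ^ p.1.1.length) ≤
            ENNReal.ofReal θ *
              ∑' p : {p : H.Walk c c' // p.IsPath ∧ ∀ v ∈ p.support, v ∈ Λ},
                ENNReal.ofReal (SAW.criticalFugacity ^ p.1.length)) →
    ∀ C θ : ℝ, 0 < θ →
      ∃ (k : ℕ) (N₀ : ℝ), 0 < N₀ ∧
        ∀ (H : SimpleGraph (Site 2)) (Λ : Set (Site 2)) (z₀ : ℂ) (N : ℝ) (u c u' c' : Site 2),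
          Λ.Finite → (∀ v ∈ Λ, dist (Site.toComplex v) z₀ ≤ C * N) → N₀ ≤ N →
          (H ≤ zdGraph 2 ∧ (∀ v : Site 2, dist (Site.toComplex v) z₀ ≤ N → v ∈ Λ) ∧
            ∀ v v' : Site 2, dist (Site.toComplex v) z₀ ≤ N + 1 →
              dist (Site.toComplex v') z₀ ≤ N + 1 → (zdGraph 2).Adj v v' → H.Adj v v') →
          (H.Adj u c ∧ u ∉ Λ ∧ c ∈ Λ ∧ dist (Site.toComplex c) z₀ ≤ N ∧
            N < dist (Site.toComplex u) z₀) →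
          (H.Adj u' c' ∧ u' ∉ Λ ∧ c' ∈ Λ ∧ dist (Site.toComplex c') z₀ ≤ N ∧
            N < dist (Site.toComplex u') z₀) →
          ∑' p : {p : {p : H.Walk c c' // p.IsPath ∧ ∀ v ∈ p.support, v ∈ Λ} //
              ∃ ι κ : Fin k → Fin (p.1.support.map Site.toComplex).length, (∀ m, ι m ≤ κ m) ∧
                (∀ m, (dist ((p.1.support.map Site.toComplex).get (ι m)) z₀ ≤ 2 * N / 5 ∧
                    3 * N / 5 ≤ dist ((p.1.support.map Site.toComplex).get (κ m)) z₀) ∨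
                  (3 * N / 5 ≤ dist ((p.1.support.map Site.toComplex).get (ι m)) z₀ ∧
                    dist ((p.1.support.map Site.toComplex).get (κ m)) z₀ ≤ 2 * N / 5)) ∧
                ∀ ⦃m m'⦄, m < m' → κ m ≤ ι m'},
              ENNReal.ofReal (SAW.criticalFugacity ^ p.1.1.length) ≤
            ENNReal.ofReal θ *
              ∑' p : {p : H.Walk c c' // p.IsPath ∧ ∀ v ∈ p.support, v ∈ Λ},
                ENNReal.ofReal (SAW.criticalFugacity ^ p.1.length) := by
  intro hX C θ hθ
  obtain ⟨k, N₀, hN₀, hk⟩ := hX θ hθ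
  exact ⟨k, N₀, hN₀, fun H Λ z₀ N u c u' c' hfin _ hN hV hD hD' => hk H Λ z₀ N u c u' c' hfin hN hV hD hD'⟩

/-- **X2c₁ᵇ ⇒ `BulkShellTightAtAspectTwo`** (rung B, then V4ʳ): the bounded-exterior atom gives per-shell traversal-count
tightness on interior shells of aspect two. [folklore] -/
theorem bulkShellTightAtAspectTwo_of_virginArcTraversalTightBounded :
    (∀ C θ : ℝ, 0 < θ →
      ∃ (k : ℕ) (N₀ : ℝ), 0 < N₀ ∧
        ∀ (H : SimpleGraph (Site 2)) (Λ : Set (Site 2)) (z₀ : ℂ) (N : ℝ) (u c u' c' : Site 2),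
          Λ.Finite → (∀ v ∈ Λ, dist (Site.toComplex v) z₀ ≤ C * N) → N₀ ≤ N →
          (H ≤ zdGraph 2 ∧ (∀ v : Site 2, dist (Site.toComplex v) z₀ ≤ N → v ∈ Λ) ∧
            ∀ v v' : Site 2, dist (Site.toComplex v) z₀ ≤ N + 1 →
              dist (Site.toComplex v') z₀ ≤ N + 1 → (zdGraph 2).Adj v v' → H.Adj v v') →
          (H.Adj u c ∧ u ∉ Λ ∧ c ∈ Λ ∧ dist (Site.toComplex c) z₀ ≤ N ∧
            N < dist (Site.toComplex u) z₀) →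
          (H.Adj u' c' ∧ u' ∉ Λ ∧ c' ∈ Λ ∧ dist (Site.toComplex c') z₀ ≤ N ∧
            N < dist (Site.toComplex u') z₀) →
          ∑' p : {p : {p : H.Walk c c' // p.IsPath ∧ ∀ v ∈ p.support, v ∈ Λ} //
              ∃ ι κ : Fin k → Fin (p.1.support.map Site.toComplex).length, (∀ m, ι m ≤ κ m) ∧
                (∀ m, (dist ((p.1.support.map Site.toComplex).get (ι m)) z₀ ≤ 2 * N / 5 ∧
                    3 * N / 5 ≤ dist ((p.1.support.map Site.toComplex).get (κ m)) z₀) ∨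
                  (3 * N / 5 ≤ dist ((p.1.support.map Site.toComplex).get (ι m)) z₀ ∧
                    dist ((p.1.support.map Site.toComplex).get (κ m)) z₀ ≤ 2 * N / 5)) ∧
                ∀ ⦃m m'⦄, m < m' → κ m ≤ ι m'},
              ENNReal.ofReal (SAW.criticalFugacity ^ p.1.1.length) ≤
            ENNReal.ofReal θ *
              ∑' p : {p : H.Walk c c' // p.IsPath ∧ ∀ v ∈ p.support, v ∈ Λ},
                ENNReal.ofReal (SAW.criticalFugacity ^ p.1.length)) →
    ∀ (D : DobrushinDomain) (a b : ℝ → Site 2), SAW.IsEndpointApprox D a b →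
      ∀ (y : ℂ) (η : ℝ), 0 < η → Metric.closedBall y (4 * η) ⊆ D.carrier →
        ∀ ε : ℝ, 0 < ε → ∃ (j : ℕ) (δ₁ : ℝ), 0 < δ₁ ∧ ∀ δ ∈ Set.Ioc (0 : ℝ) δ₁,
          SAW.law D.carrier δ (a δ) (b δ)
            {γ | (⟨γ.walk.toCurve (meshPoint δ)⟩ : Curve ℂ).HasTraversals j y η (2 * η)} ≤
            ENNReal.ofReal ε :=
  fun hX => bulkShellTightAtAspectTwo_of_virginArcTraversalTightReach (virginArcTraversalTightReach_of_bounded hX)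

/-- **The bulk child modulo the bounded atom**: X2c₁ᵇ (`stub_virginArcTraversalTightBounded`, verbatim) implies
`BulkShellTight` (stmt-CriticalPhenomena-17588, verbatim) — rung B, V4ʳ, then the aspect reduction A. [folklore] -/
theorem bulkShellTight_of_virginArcTraversalTightBounded :
    (∀ C θ : ℝ, 0 < θ →
      ∃ (k : ℕ) (N₀ : ℝ), 0 < N₀ ∧
        ∀ (H : SimpleGraph (Site 2)) (Λ : Set (Site 2)) (z₀ : ℂ) (N : ℝ) (u c u' c' : Site 2),
          Λ.Finite → (∀ v ∈ Λ, dist (Site.toComplex v) z₀ ≤ C * N) → N₀ ≤ N →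
          (H ≤ zdGraph 2 ∧ (∀ v : Site 2, dist (Site.toComplex v) z₀ ≤ N → v ∈ Λ) ∧
            ∀ v v' : Site 2, dist (Site.toComplex v) z₀ ≤ N + 1 →
              dist (Site.toComplex v') z₀ ≤ N + 1 → (zdGraph 2).Adj v v' → H.Adj v v') →
          (H.Adj u c ∧ u ∉ Λ ∧ c ∈ Λ ∧ dist (Site.toComplex c) z₀ ≤ N ∧
            N < dist (Site.toComplex u) z₀) →
          (H.Adj u' c' ∧ u' ∉ Λ ∧ c' ∈ Λ ∧ dist (Site.toComplex c') z₀ ≤ N ∧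
            N < dist (Site.toComplex u') z₀) →
          ∑' p : {p : {p : H.Walk c c' // p.IsPath ∧ ∀ v ∈ p.support, v ∈ Λ} //
              ∃ ι κ : Fin k → Fin (p.1.support.map Site.toComplex).length, (∀ m, ι m ≤ κ m) ∧
                (∀ m, (dist ((p.1.support.map Site.toComplex).get (ι m)) z₀ ≤ 2 * N / 5 ∧
                    3 * N / 5 ≤ dist ((p.1.support.map Site.toComplex).get (κ m)) z₀) ∨
                  (3 * N / 5 ≤ dist ((p.1.support.map Site.toComplex).get (ι m)) z₀ ∧
                    dist ((p.1.support.map Site.toComplex).get (κ m)) z₀ ≤ 2 * N / 5)) ∧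
                ∀ ⦃m m'⦄, m < m' → κ m ≤ ι m'},
              ENNReal.ofReal (SAW.criticalFugacity ^ p.1.1.length) ≤
            ENNReal.ofReal θ *
              ∑' p : {p : H.Walk c c' // p.IsPath ∧ ∀ v ∈ p.support, v ∈ Λ},
                ENNReal.ofReal (SAW.criticalFugacity ^ p.1.length)) →
    ∀ (D : DobrushinDomain) (a b : ℝ → Site 2), SAW.IsEndpointApprox D a b →
      ∀ (y : ℂ) (η R : ℝ), 0 < η → η < R → Metric.closedBall y (2 * R) ⊆ D.carrier →
        ∀ ε : ℝ, 0 < ε → ∃ (j : ℕ) (δ₁ : ℝ), 0 < δ₁ ∧ ∀ δ ∈ Set.Ioc (0 : ℝ) δ₁,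
          SAW.law D.carrier δ (a δ) (b δ)
            {γ | (⟨γ.walk.toCurve (meshPoint δ)⟩ : Curve ℂ).HasTraversals j y η R} ≤ ENNReal.ofReal ε :=
  fun hX => stub_aspectReduction (bulkShellTightAtAspectTwo_of_virginArcTraversalTightBounded hX)

/-- **The crux modulo its two research leaves, bounded form**: X2c₁ᵇ (`stub_virginArcTraversalTightBounded`) and restriction
positivity E (`stub_confinementPositivity` = `ConfinementPositivity`, stmt-CriticalPhenomena-17587) imply `EventualTight`
(stmt-CriticalPhenomena-1372), through the split glue `EventualTight_of_subs`. [folklore] -/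
theorem eventualTight_of_virginArcTraversalTightBounded_of_confinementPositivity :
    (∀ C θ : ℝ, 0 < θ →
      ∃ (k : ℕ) (N₀ : ℝ), 0 < N₀ ∧
        ∀ (H : SimpleGraph (Site 2)) (Λ : Set (Site 2)) (z₀ : ℂ) (N : ℝ) (u c u' c' : Site 2),
          Λ.Finite → (∀ v ∈ Λ, dist (Site.toComplex v) z₀ ≤ C * N) → N₀ ≤ N →
          (H ≤ zdGraph 2 ∧ (∀ v : Site 2, dist (Site.toComplex v) z₀ ≤ N → v ∈ Λ) ∧
            ∀ v v' : Site 2, dist (Site.toComplex v) z₀ ≤ N + 1 →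
              dist (Site.toComplex v') z₀ ≤ N + 1 → (zdGraph 2).Adj v v' → H.Adj v v') →
          (H.Adj u c ∧ u ∉ Λ ∧ c ∈ Λ ∧ dist (Site.toComplex c) z₀ ≤ N ∧
            N < dist (Site.toComplex u) z₀) →
          (H.Adj u' c' ∧ u' ∉ Λ ∧ c' ∈ Λ ∧ dist (Site.toComplex c') z₀ ≤ N ∧
            N < dist (Site.toComplex u') z₀) →
          ∑' p : {p : {p : H.Walk c c' // p.IsPath ∧ ∀ v ∈ p.support, v ∈ Λ} //
              ∃ ι κ : Fin k → Fin (p.1.support.map Site.toComplex).length, (∀ m, ι m ≤ κ m) ∧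
                (∀ m, (dist ((p.1.support.map Site.toComplex).get (ι m)) z₀ ≤ 2 * N / 5 ∧
                    3 * N / 5 ≤ dist ((p.1.support.map Site.toComplex).get (κ m)) z₀) ∨
                  (3 * N / 5 ≤ dist ((p.1.support.map Site.toComplex).get (ι m)) z₀ ∧
                    dist ((p.1.support.map Site.toComplex).get (κ m)) z₀ ≤ 2 * N / 5)) ∧
                ∀ ⦃m m'⦄, m < m' → κ m ≤ ι m'},
              ENNReal.ofReal (SAW.criticalFugacity ^ p.1.1.length) ≤
            ENNReal.ofReal θ *
              ∑' p : {p : H.Walk c c' // p.IsPath ∧ ∀ v ∈ p.support, v ∈ Λ},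
                ENNReal.ofReal (SAW.criticalFugacity ^ p.1.length)) →
    (∀ (D D' : DobrushinDomain) (a b : ℝ → Site 2) (d : ℝ), 0 < d →
      D'.carrier ⊆ D.carrier → D'.pt 0 = D.pt 0 → D'.pt 1 = D.pt 1 →
      D.carrier ∩ (Metric.ball (D.pt 0) d ∪ Metric.ball (D.pt 1) d) ⊆ D'.carrier →
      SAW.IsEndpointApprox D' a b →
        ∃ c δ₀ : ℝ, 0 < c ∧ 0 < δ₀ ∧ ∀ δ ∈ Set.Ioc (0 : ℝ) δ₀,
          ENNReal.ofReal c ≤ SAW.law D.carrier δ (a δ) (b δ)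
            {γ | ∃ γ' : SAW.DomainSAW D'.carrier δ (a δ) (b δ),
              γ'.walk.support = γ.walk.support}) →
    Summit.CriticalPhenomena.SAWScalingLimit.Theses.SAWRenewalTightness.EventualTight :=
  fun hX hE => EventualTight_of_subs hE (bulkShellTight_of_virginArcTraversalTightBounded hX)

end Summit.CriticalPhenomena.SAWScalingLimit.Theorems

end
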